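import Literature.Computability.AlgebraicComplexity.BI17FundamentalInvariantForms
import Literature.Computability.AlgebraicComplexity.DetOrbitClosureDimension
import Literature.RingTheory.KrullDimension.TangentDimension
import Literature.RingTheory.KrullDimension.ZariskiClosureInfinite
import Literature.RingTheory.KrullDimension.FibreInequality
import Mathlib.LinearAlgebra.Matrix.Rank
import Mathlib.RingTheory.Jacobson.Ring
import Mathlib.RingTheory.Nullstellensatz
import HarnessLib

/-!
# BI 2017 Thm. 2.3 (first sentence): the finite-stabilizer locus is a non-empty open set

Bürgisser–Ikenmeyer, *Fundamental invariants of orbit closures* (J. Algebra 477 (2017) =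
arXiv:1511.02927), Thm. 2.3, first sentence (`paper:arxiv-1511.02927` p0006.txt:L56–58):
"Let `D > 2` and `m ≥ 1`. The set of `w ∈ Sym^D ℂ^m` with finite stabilizer is a nonempty open
subset of `W`." This file DISCHARGES the named fact `BI2017_thm_2_3_open`
(`BI17FundamentalInvariantForms.lean`, typed: a set `S` of polynomial functions on `Sym^D` with
`stab(f)` finite iff some `F ∈ S` does not vanish at `f`, for every form `f` of degree `D`; and a
form with finite stabilizer exists) — `BI2017_thm_2_3_open_holds`.

The print "indicates the proof in the Appendix" (§7.2, generic stabilizers after Matsumura–Monsky);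
the sentence itself is the standard upper-semicontinuity of stabilizer dimensions, and is proved
here from the Lie-algebra criterion, with every input already in the tree:

* **`finite_linStabilizer_iff_glAnn_eq_bot`** — for a form `f` over `ℂ`, `stab(f) ⊆ GL(W)` is
  finite iff the annihilator `𝔤𝔩(W)_f = glAnn f` (`GLAnnihilator.lean`, the Lie algebra of the
  stabilizer) is zero.
  (⇐, `finite_linStabilizer_of_glAnn_eq_bot`, any polynomial `f`): an infinite stabilizer is an
  infinite set of points of matrix space, so some component of its Zariski closure is
  positive-dimensional (`KrullDimension.exists_mem_minimalPrimes_inter_infinite`) and carries a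
  stabilizer point `g₀` with a non-zero Zariski tangent vector `B`
  (`KrullDimension.height_le_finrank_tangentSpaceAt`); differentiating the stabilizer equations
  `coeff_d (Y·f) = coeff_d f` at `g₀` along `B` with dual numbers
  (`KrullDimension.snd_aeval_dualNumberPoint`) and translating by `g₀` gives
  `0 ≠ B g₀⁻¹ ∈ glAnn f` (`eval_one_pderiv_orbitMapCoeff`, `OrbitClosureDimension.lean`).
  (⇒, `glAnn_eq_bot_of_finite_linStabilizer`): the fibre-dimension inequality
  (`KrullDimension.ringKrullDim_le_ringKrullDim_quotient_add`, Springer 5.1.6 / Matsumura 15.1)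
  for the orbit comorphism `ℂ[Δ(f)] → ℂ[Y]` (the tree's `genericOrbitMap`, written out) at the
  point `f`, together with
  `dim Δ(f) = N² − dim glAnn f` (`affineDimension_orbitClosure_eq_card_sq_sub_finrank_glAnn`,
  `ringKrullDim_orbitCoordRing_eq_affineDimension_orbitClosure`): the fibre over `f` — the
  stabilizer, read in `Mat(W)` — has a component through `Y = 1` of dimension `≥ dim glAnn f`, and
  if that is positive the Jacobson property of `ℂ[Y]` yields infinitely many invertible points on
  it, all stabilizing `f`.
* **openness** (`finite_linStabilizer_iff_exists_tangentMinor_ne_zero`): `glAnn f = 0` iff the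
  matrix `(coeff_δ (x_a ∂_b f))_{δ,(a,b)}` of the infinitesimal action has a non-zero maximal
  minor; these minors are polynomial functions on `Sym^D` (determinants of submatrices of the
  generic matrix `(∑_γ coeff_δ(x_a ∂_b x^γ) · c_γ)`), and `S` is the set of all of them.
* **witness** (`glAnn_sum_X_pow_eq_bot`): for `D ≥ 3` the Fermat form `∑ x_i^D` has zero
  annihilator (the monomials `x_a x_b^{D−1}` are pairwise distinct), hence finite stabilizer (in
  accordance with BI Prop. 2.4 (2), `BI2017_prop_2_4_2`: its stabilizer is the monomial group
  `μ_D ≀ S_m`).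

Theorem-only: no definitions, no named facts, no instances. Honest framing: a classical statement
about stabilizers of forms; VP ≠ VNP is NOT proved and nothing here bears on it.

## References

* [BurgisserIkenmeyer2017] P. Bürgisser, C. Ikenmeyer, *Fundamental invariants of orbit closures*,
  J. Algebra 477 (2017) 390–434 = arXiv:1511.02927, Thm. 2.3.
* [SpringerLAG1998] T. A. Springer, *Linear Algebraic Groups*, 2nd ed., 4.1.2–4.3.3 (tangent
  spaces), 5.1.6 (fibres of morphisms).
* [Matsumura1987] H. Matsumura, *Commutative Ring Theory*, Thm 5.6, Thm 15.1.
* [Humphreys1990] J. E. Humphreys, *Reflection Groups and Coxeter Groups*, § 3.10 (Jacobian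
  criterion, behind `OrbitClosureDimension.lean`).
-/

noncomputable section

namespace Literature.Computability.AlgebraicComplexity

open MvPolynomial Matrix Literature.RingTheory.KrullDimension

variable {σ : Type*} [Fintype σ] [DecidableEq σ]

/-! ### Generalities: the orbit map coefficients under base change, coefficients of `X · f` -/

section General

omit [DecidableEq σ] in
/-- **The generic orbit map under base change**: evaluating the coefficient `φ_d = coeff_d P(Yᵀx)`
of the generic orbit map at an `R`-valued matrix `y` (any commutative `ℂ`-algebra `R`) gives the
`d`-th coefficient of `P(yᵀ x)` computed over `R`. [cite: MulmuleySohoniSIAM2001, §4] -/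
theorem aeval_orbitMapCoeff {R : Type*} [CommRing R] [Algebra ℂ R] (P : MvPolynomial σ ℂ)
    (d : σ →₀ ℕ) (y : σ × σ → R) :
    aeval y (OrbitDim.orbitMapCoeff P d) =
      coeff d (linSubst σ R (Matrix.of fun i j => y (i, j)) (map (algebraMap ℂ R) P)) := by
  unfold OrbitDim.orbitMapCoeff OrbitDim.genSubst
  rw [← AlgHom.coe_toRingHom, ← coeff_map, map_linSubst, map_map]
  have h1 : (Matrix.mvPolynomialX σ σ ℂ).map ⇑((aeval y : MvPolynomial (σ × σ) ℂ →ₐ[ℂ] R) :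
      MvPolynomial (σ × σ) ℂ →+* R) = Matrix.of fun i j => y (i, j) := by
    ext i j
    simp only [Matrix.map_apply, Matrix.mvPolynomialX_apply, RingHom.coe_coe, aeval_X,
      Matrix.of_apply]
  have h2 : ((aeval y : MvPolynomial (σ × σ) ℂ →ₐ[ℂ] R) : MvPolynomial (σ × σ) ℂ →+* R).comp
      (C : ℂ →+* MvPolynomial (σ × σ) ℂ) = algebraMap ℂ R := by
    ext c
    simp only [RingHom.comp_apply, RingHom.coe_coe, aeval_C]
  rw [h1, h2]

omit [DecidableEq σ] in
/-- `φ_d(A) = coeff_d (A·P)` for a complex matrix `A`. [cite: MulmuleySohoniSIAM2001, §4] -/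
theorem eval_orbitMapCoeff (P : MvPolynomial σ ℂ) (d : σ →₀ ℕ) (A : Matrix σ σ ℂ) :
    eval (fun ij : σ × σ => A ij.1 ij.2) (OrbitDim.orbitMapCoeff P d) =
      coeff d (linSubst σ ℂ A P) := by
  unfold OrbitDim.orbitMapCoeff OrbitDim.genSubst
  exact eval_coeff_genericLinSubst P d A

omit [DecidableEq σ] in
/-- The coefficients of the infinitesimal action: `coeff_d (X·P) = ∑_{a,b} X_{ab} coeff_d (x_a ∂_b P)`.
[cite: LandsbergManivelRessayre2013, §3.4 (p. 479)] -/
theorem coeff_glTangentMap (P : MvPolynomial σ ℂ) (M : Matrix σ σ ℂ) (d : σ →₀ ℕ) :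
    coeff d (glTangentMap P M) = ∑ a, ∑ b, M a b * coeff d (X a * pderiv b P) := by
  rw [glTangentMap_apply, coeff_sum]
  refine Finset.sum_congr rfl fun a _ => ?_
  rw [coeff_sum]
  refine Finset.sum_congr rfl fun b _ => ?_
  rw [coeff_smul, smul_eq_mul]

omit [Fintype σ] [DecidableEq σ] in
/-- `x_a ∂_b P` is a form of degree `n` if `P` is. [folklore] -/
private theorem isHomogeneous_X_mul_pderiv' {P : MvPolynomial σ ℂ} {n : ℕ} (hP : P.IsHomogeneous n)
    (a b : σ) : (X a * pderiv b P).IsHomogeneous n := by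
  rcases Nat.eq_zero_or_pos n with rfl | hn
  · -- `P` is a constant, `∂_b P = 0`
    have h0 : P.totalDegree = 0 := Nat.le_zero.mp hP.totalDegree_le
    rw [totalDegree_eq_zero_iff_eq_C.mp h0, pderiv_C, mul_zero]
    exact isHomogeneous_zero σ ℂ 0
  · have h := (isHomogeneous_X ℂ a).mul
      (Literature.Algebra.Polynomial.JacobianCriterion.isHomogeneous_pderiv hP b)
    rwa [show 1 + (n - 1) = n by omega] at h

omit [DecidableEq σ] in
/-- `X·P` is a form of degree `n` if `P` is. [folklore] -/
private theorem glTangentMap_isHomogeneous {P : MvPolynomial σ ℂ} {n : ℕ} (hP : P.IsHomogeneous n)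
    (M : Matrix σ σ ℂ) : (glTangentMap P M).IsHomogeneous n := by
  rw [glTangentMap_apply]
  refine IsHomogeneous.sum _ _ _ fun a _ => IsHomogeneous.sum _ _ _ fun b _ => ?_
  rw [smul_eq_C_mul]
  exact (isHomogeneous_X_mul_pderiv' hP a b).C_mul _

end General

/-! ### `glAnn f = 0 ⇒ stab(f)` finite: tangent vectors of an infinite stabilizer -/

section Finite

open TrivSqZeroExt DualNumber

omit [DecidableEq σ] in
/-- Products of a purely infinitesimal and a classical matrix over the dual numbers:
`(εM)·N = ε(MN)`. [folklore] -/
private theorem map_inr_mul_map_inl (M N : Matrix σ σ ℂ) :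
    M.map (inr : ℂ → ℂ[ε]) * N.map (inl : ℂ → ℂ[ε]) = (M * N).map inr := by
  ext i j
  · simp only [Matrix.mul_apply, Matrix.map_apply, fst_sum, fst_mul, fst_inr, zero_mul,
      Finset.sum_const_zero]
  · simp only [Matrix.mul_apply, Matrix.map_apply, snd_sum, DualNumber.snd_mul, fst_inr, snd_inl,
      fst_inl, snd_inr, mul_zero, zero_add]

/-- **`glAnn f = 0` forces a finite stabilizer** (any polynomial `f` over `ℂ`). If `stab(f)` is
infinite, the Zariski closure of this set of points of `Mat(W)` has a positive-dimensional component
`Z(𝔭)` (`exists_mem_minimalPrimes_inter_infinite`); at a stabilizer point `g₀ ∈ Z(𝔭)` the local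
ring has a maximal ideal of positive height, so the Zariski tangent space `T_{g₀}` is non-zero
(`height_le_finrank_tangentSpaceAt`, Springer 4.3.3 (iii)); a tangent vector `B ≠ 0` kills the
differentials of the stabilizer equations `coeff_d(Y·f) − coeff_d f ∈ 𝔭`, i.e. (dual numbers,
`snd_aeval_dualNumberPoint`) `coeff_d f((g₀ + εB)ᵀx)` has no `ε`-part; writing
`g₀ + εB = (1 + εM) g₀` with `M = B g₀⁻¹` and using `g₀·f = f`, this says `coeff_d (M·f) = 0` for
all `d` (`eval_one_pderiv_orbitMapCoeff`), so `0 ≠ M ∈ glAnn f`.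
[cite: SpringerLAG1998, Thm 4.3.3 (iii)] -/
theorem finite_linStabilizer_of_glAnn_eq_bot (f : MvPolynomial σ ℂ) (h : glAnn f = ⊥) :
    Finite (linStabilizer f) := by
  classical
  by_contra hinf
  rw [not_finite_iff_infinite] at hinf
  -- the stabilizer as an infinite set of points of matrix space
  let pt : GL σ ℂ → (σ × σ → ℂ) := fun γ ij => (γ : Matrix σ σ ℂ) ij.1 ij.2
  have hpt_inj : Function.Injective pt := by
    intro γ γ' hγ
    exact Matrix.GeneralLinearGroup.ext fun i j => congr_fun hγ (i, j)
  set S : Set (σ × σ → ℂ) := pt '' (linStabilizer f : Set (GL σ ℂ)) with hS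
  have hSinf : S.Infinite :=
    (Set.infinite_coe_iff.mp hinf).image hpt_inj.injOn
  obtain ⟨𝔭, h𝔭min, hinf', -, hnotmax, -⟩ :=
    exists_mem_minimalPrimes_inter_infinite (k := ℂ) (K := ℂ) hSinf
  haveI h𝔭 : 𝔭.IsPrime := h𝔭min.1.1
  have hIS : MvPolynomial.vanishingIdeal ℂ S ≤ 𝔭 := h𝔭min.1.2
  obtain ⟨a, haS, ha𝔭⟩ := hinf'.nonempty
  obtain ⟨γ₀, hγ₀, rfl⟩ := haS
  have hγ₀f : linSubst σ ℂ (γ₀ : Matrix σ σ ℂ) f = f := by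
    have := mem_linStabilizer.mp hγ₀
    rwa [linSubstRep_apply] at this
  have ha : ∀ p ∈ 𝔭, eval (pt γ₀) p = 0 := fun p hp => by
    rw [← aeval_apply_eq_eval]; exact (MvPolynomial.mem_zeroLocus_iff.mp ha𝔭) p hp
  -- the maximal ideal of `g₀` in `ℂ[Y] ⧸ 𝔭` has positive height, so the tangent space is non-zero
  haveI : IsDomain (MvPolynomial (σ × σ) ℂ ⧸ 𝔭) := Ideal.Quotient.isDomain 𝔭
  have hnf : ¬ IsField (MvPolynomial (σ × σ) ℂ ⧸ 𝔭) := fun hF =>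
    hnotmax ((Ideal.Quotient.maximal_ideal_iff_isField_quotient 𝔭).mpr hF)
  haveI := isMaximal_pointIdeal (pointOfZero 𝔭 (pt γ₀) ha)
  have hbot : ⊥ < pointIdeal (pointOfZero 𝔭 (pt γ₀) ha) := Ideal.bot_lt_of_maximal _ hnf
  have hheight : (pointIdeal (pointOfZero 𝔭 (pt γ₀) ha)).height ≠ 0 := by
    rw [Ne, Ideal.height_eq_zero_iff_eq_bot]
    exact hbot.ne'
  have h1 : (1 : ℕ∞) ≤ Module.finrank ℂ (tangentSpaceAt 𝔭 (pt γ₀)) :=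
    (Order.one_le_iff_ne_zero.mpr hheight).trans (height_le_finrank_tangentSpaceAt 𝔭 (pt γ₀) ha)
  have h1' : 0 < Module.finrank ℂ (tangentSpaceAt 𝔭 (pt γ₀)) := by
    have : (1 : ℕ) ≤ Module.finrank ℂ (tangentSpaceAt 𝔭 (pt γ₀)) := by exact_mod_cast h1
    omega
  obtain ⟨v, hv⟩ := Module.finrank_pos_iff_exists_ne_zero.mp h1'
  -- the tangent vector as a matrix `B`, and `M = B g₀⁻¹`
  set B : Matrix σ σ ℂ := Matrix.of fun i j => (v : σ × σ → ℂ) (i, j) with hB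
  have hBne : B ≠ 0 := by
    intro hB0
    apply hv
    apply Subtype.ext
    funext ij
    have := congr_fun (congr_fun hB0 ij.1) ij.2
    simpa [hB] using this
  set g₀ : Matrix σ σ ℂ := (γ₀ : Matrix σ σ ℂ) with hg₀
  set g₀i : Matrix σ σ ℂ := ((γ₀⁻¹ : GL σ ℂ) : Matrix σ σ ℂ) with hg₀i
  have hgi : g₀i * g₀ = 1 := by
    rw [hg₀i, hg₀, ← Units.val_mul, inv_mul_cancel, Units.val_one]
  set M : Matrix σ σ ℂ := B * g₀i with hM
  have hMg : M * g₀ = B := by rw [hM, Matrix.mul_assoc, hgi, Matrix.mul_one]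
  -- the key computation: `coeff_d (M·f) = 0` for every `d`
  have key : ∀ d : σ →₀ ℕ, coeff d (glTangentMap f M) = 0 := by
    intro d
    -- the stabilizer equation `φ_d − coeff_d f` lies in `𝔭`
    have hQ : OrbitDim.orbitMapCoeff f d - C (coeff d f) ∈ 𝔭 := by
      apply hIS
      rw [MvPolynomial.mem_vanishingIdeal_iff]
      rintro _ ⟨γ, hγ, rfl⟩
      have hγf : linSubst σ ℂ (γ : Matrix σ σ ℂ) f = f := by
        have := mem_linStabilizer.mp (show γ ∈ linStabilizer f from hγ)
        rwa [linSubstRep_apply] at this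
      rw [map_sub, aeval_C, aeval_apply_eq_eval, eval_orbitMapCoeff, hγf, Algebra.algebraMap_self_apply, sub_self]
    -- its differential at `g₀` kills `v`
    have htan : linearFormOfVector (pt γ₀) (v : σ × σ → ℂ) (OrbitDim.orbitMapCoeff f d) = 0 := by
      have h0 := linearFormOfVector_eq_zero 𝔭 (pt γ₀) v _ hQ
      rw [map_sub] at h0
      have hC : linearFormOfVector (pt γ₀) (v : σ × σ → ℂ)
          (C (coeff d f) : MvPolynomial (σ × σ) ℂ) = 0 := by
        rw [linearFormOfVector_apply]
        simp only [pderiv_C, map_zero, zero_mul, Finset.sum_const_zero]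
      rwa [hC, sub_zero] at h0
    -- dual numbers: `φ_d((g₀ + εB)) = φ_d((1 + εM))`
    let fε : MvPolynomial σ ℂ[ε] := map (algebraMap ℂ ℂ[ε]) f
    have hG₀ : linSubst σ ℂ[ε] (g₀.map (algebraMap ℂ ℂ[ε])) fε = fε := by
      rw [← map_linSubst, hγ₀f]
    have hGε : (Matrix.of fun i j => dualNumberPoint (pt γ₀) (v : σ × σ → ℂ) (i, j)) =
        (1 + M.map (inr : ℂ → ℂ[ε])) * g₀.map (algebraMap ℂ ℂ[ε]) := by
      rw [add_mul, one_mul, TrivSqZeroExt.algebraMap_eq_inl, map_inr_mul_map_inl, hMg]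
      ext i j
      · simp only [Matrix.of_apply, dualNumberPoint, Matrix.add_apply, Matrix.map_apply, fst_add,
          fst_inl, fst_inr, add_zero, pt, hg₀]
      · simp only [Matrix.of_apply, dualNumberPoint, Matrix.add_apply, Matrix.map_apply, snd_add,
          snd_inl, snd_inr, zero_add, hB]
    have hOne : (Matrix.of fun i j => dualNumberPoint (fun ij : σ × σ => (1 : Matrix σ σ ℂ) ij.1 ij.2)
        (fun ij : σ × σ => M ij.1 ij.2) (i, j)) = 1 + M.map (inr : ℂ → ℂ[ε]) := by
      ext i j
      · simp only [Matrix.of_apply, dualNumberPoint, Matrix.add_apply, Matrix.map_apply, fst_add,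
          fst_inl, fst_inr, add_zero, Matrix.one_apply]
        split_ifs <;> simp
      · simp only [Matrix.of_apply, dualNumberPoint, Matrix.add_apply, Matrix.map_apply, snd_add,
          snd_inl, snd_inr, zero_add, Matrix.one_apply]
        split_ifs <;> simp
    have heq : aeval (dualNumberPoint (pt γ₀) (v : σ × σ → ℂ)) (OrbitDim.orbitMapCoeff f d) =
        aeval (dualNumberPoint (fun ij : σ × σ => (1 : Matrix σ σ ℂ) ij.1 ij.2)
          (fun ij : σ × σ => M ij.1 ij.2)) (OrbitDim.orbitMapCoeff f d) := by
      rw [aeval_orbitMapCoeff, aeval_orbitMapCoeff, hGε, hOne, linSubst_mul, AlgHom.comp_apply, hG₀]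
    -- compare the `ε`-parts
    have hsnd := congrArg TrivSqZeroExt.snd heq
    rw [snd_aeval_dualNumberPoint, snd_aeval_dualNumberPoint, htan] at hsnd
    rw [coeff_glTangentMap]
    rw [linearFormOfVector_apply, Fintype.sum_prod_type] at hsnd
    simp only [OrbitDim.eval_one_pderiv_orbitMapCoeff] at hsnd
    rw [hsnd]
    exact Finset.sum_congr rfl fun a _ => Finset.sum_congr rfl fun b _ => mul_comm _ _
  have hM0 : M = 0 := by
    have hmem : M ∈ glAnn f := by
      rw [mem_glAnn_iff_glTangentMap_eq_zero]
      exact MvPolynomial.ext _ _ fun d => by rw [key, coeff_zero]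
    rw [h] at hmem
    exact (Submodule.mem_bot ℂ).mp hmem
  apply hBne
  rw [← hMg, hM0, Matrix.zero_mul]

end Finite

/-! ### `stab(f)` finite `⇒ glAnn f = 0`: the fibre of the orbit map over `f` -/

section Converse

/-- **Jacobson step.** For a non-maximal prime `P` of the polynomial ring `ℂ[Y_ι]` (`ι` finite) and
`g ∉ P`, infinitely many points of `Z(P)` have `g ≠ 0`: otherwise, with `a` in all the (finitely
many) point ideals of such points but not in `P`, the product `g a` lies in every maximal ideal above
`P` (Nullstellensatz: these are point ideals), i.e. in the Jacobson radical of `P`, which is `P`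
since `ℂ[Y]` is a Jacobson ring — contradicting primality. [folklore] -/
private theorem infinite_points_of_not_isMaximal {ι : Type*} [Finite ι]
    (P : Ideal (MvPolynomial ι ℂ)) [hP : P.IsPrime] (hPmax : ¬ P.IsMaximal)
    {g : MvPolynomial ι ℂ} (hg : g ∉ P) :
    {x : ι → ℂ | (∀ p ∈ P, aeval x p = 0) ∧ aeval x g ≠ 0}.Infinite := by
  classical
  intro hTfin
  set J : Ideal (MvPolynomial ι ℂ) :=
    hTfin.toFinset.inf fun x => MvPolynomial.vanishingIdeal ℂ {x} with hJ
  have hJP : ¬ J ≤ P := by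
    intro hle
    rw [hJ, Ideal.IsPrime.inf_le' hP] at hle
    obtain ⟨x, -, hxP⟩ := hle
    apply hPmax
    have hmax : (MvPolynomial.vanishingIdeal ℂ {x} : Ideal (MvPolynomial ι ℂ)).IsMaximal :=
      inferInstance
    rw [← hmax.eq_of_le hP.ne_top hxP]
    exact hmax
  obtain ⟨a, haJ, haP⟩ := SetLike.not_le_iff_exists.mp hJP
  have hmem : g * a ∈ P.jacobson := by
    rw [Ideal.jacobson, Ideal.mem_sInf]
    rintro M ⟨hPM, hMmax⟩
    obtain ⟨x, rfl⟩ := (MvPolynomial.isMaximal_iff_eq_vanishingIdeal_singleton).mp hMmax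
    rw [MvPolynomial.mem_vanishingIdeal_singleton_iff, map_mul]
    by_cases hgx : aeval x g = 0
    · rw [hgx, zero_mul]
    · have hxT : x ∈ {x : ι → ℂ | (∀ p ∈ P, aeval x p = 0) ∧ aeval x g ≠ 0} :=
        ⟨fun p hp => (MvPolynomial.mem_vanishingIdeal_singleton_iff x p).mp (hPM hp), hgx⟩
      have hJle : J ≤ MvPolynomial.vanishingIdeal ℂ {x} := by
        rw [hJ]
        exact Finset.inf_le (hTfin.mem_toFinset.mpr hxT)
      have haM := hJle haJ
      rw [MvPolynomial.mem_vanishingIdeal_singleton_iff] at haM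
      rw [haM, mul_zero]
  rw [isJacobsonRing_iff_prime_eq.mp inferInstance P hP] at hmem
  rcases hP.mem_or_mem hmem with h1 | h1
  · exact hg h1
  · exact haP h1

/-- Values of the orbit comorphism `F ↦ F(Y·f)` (`X_d ↦ φ_d = orbitMapCoeff f d`; the tree's
`genericOrbitMap`, written out to avoid its ambient `LinearOrder σ`): `(F(Y·f))(A) = F(A·f)`.
[cite: MulmuleySohoniSIAM2001, §4] -/
private theorem eval_orbitComap (D : ℕ) (f : MvPolynomial σ ℂ) (F : MvPolynomial (DegIdx σ D) ℂ)
    (A : Matrix σ σ ℂ) :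
    eval (fun ij : σ × σ => A ij.1 ij.2)
        (aeval (fun d : DegIdx σ D => OrbitDim.orbitMapCoeff f d.1) F) =
      aeval (formCoeff D (linSubst σ ℂ A f)) F := by
  rw [← aeval_apply_eq_eval]
  exact aeval_genericOrbitMap f D F A

/-- The fibre ideal of the orbit map over the point `f` — generated by the pull-backs `F(Y·f)` of the
polynomial functions `F` vanishing at `f` — vanishes at every matrix `A` with `A·f = f`.
[cite: MulmuleySohoniSIAM2001, §4] -/
private theorem fibreIdeal_le_of_linSubst_eq {D : ℕ} {f : MvPolynomial σ ℂ} {A : Matrix σ σ ℂ}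
    (hA : linSubst σ ℂ A f = f) :
    (MvPolynomial.vanishingIdeal ℂ {formCoeff D f}).map
        (aeval fun d : DegIdx σ D => OrbitDim.orbitMapCoeff f d.1) ≤
      MvPolynomial.vanishingIdeal ℂ {fun ij : σ × σ => A ij.1 ij.2} := by
  rw [Ideal.map_le_iff_le_comap]
  intro b hb
  rw [Ideal.mem_comap, MvPolynomial.mem_vanishingIdeal_singleton_iff, aeval_apply_eq_eval,
    eval_orbitComap, hA]
  exact (MvPolynomial.mem_vanishingIdeal_singleton_iff _ b).mp hb

/-- Conversely, a zero `A` of the fibre ideal satisfies `A·f = f` (`f` a form of degree `D`: compare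
the degree-`D` coefficients, `X_δ − f_δ` vanishing at `f`). [cite: MulmuleySohoniSIAM2001, §4] -/
private theorem linSubst_eq_of_fibreIdeal_le {D : ℕ} {f : MvPolynomial σ ℂ} (hf : f.IsHomogeneous D)
    {A : Matrix σ σ ℂ}
    (hA : (MvPolynomial.vanishingIdeal ℂ {formCoeff D f}).map
        (aeval fun d : DegIdx σ D => OrbitDim.orbitMapCoeff f d.1) ≤
      MvPolynomial.vanishingIdeal ℂ {fun ij : σ × σ => A ij.1 ij.2}) :
    linSubst σ ℂ A f = f := by
  have hfmem : f ∈ homogeneousSubmodule σ ℂ D := (mem_homogeneousSubmodule D f).mpr hf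
  apply formCoeff_injOn_homogeneousSubmodule D (linSubst_mem_homogeneousSubmodule A hfmem) hfmem
  funext δ
  have hb : (X δ - C (formCoeff D f δ) : MvPolynomial (DegIdx σ D) ℂ) ∈
      MvPolynomial.vanishingIdeal ℂ {formCoeff D f} := by
    rw [MvPolynomial.mem_vanishingIdeal_singleton_iff, map_sub, aeval_X, aeval_C,
      Algebra.algebraMap_self_apply, sub_self]
  have h2 := hA (Ideal.mem_map_of_mem _ hb)
  rw [MvPolynomial.mem_vanishingIdeal_singleton_iff, aeval_apply_eq_eval, eval_orbitComap,
    map_sub, aeval_X, aeval_C, Algebra.algebraMap_self_apply, sub_eq_zero] at h2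
  exact h2

/-- **The fibre over `f` has a positive-dimensional component through `Y = 1` when
`glAnn f ≠ 0`.** With `N = dim glAnn f ≥ 1`: the orbit comorphism `φ : ℂ[Δ(f)] → ℂ[Y]`
(`F ↦ F(Y·f)` through `OrbitCoordRing f D = ℂ[Sym^D] ⧸ I(GL·f)`) is a map of affine domains,
`dim ℂ[Y] = m²`, `dim ℂ[Δ(f)] = m² − N` (`ringKrullDim_orbitCoordRing_eq_affineDimension_orbitClosure`,
`affineDimension_orbitClosure_eq_card_sq_sub_finrank_glAnn`); a minimal prime `P` of the fibre ideal
below the point `Y = 1` has `dim ℂ[Y] ≤ dim ℂ[Y]/P + dim ℂ[Δ(f)]`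
(`ringKrullDim_le_ringKrullDim_quotient_add`, Springer 5.1.6), so `dim ℂ[Y]/P ≥ 1`: `P` is not
maximal; and the zeros of `P` (zeros of the fibre ideal) are matrices `A` with `A·f = f`.
[cite: SpringerLAG1998, 5.1.6] -/
private theorem exists_fibre_prime_not_isMaximal {f : MvPolynomial σ ℂ} {D : ℕ}
    (hf : f.IsHomogeneous D) (hne : glAnn f ≠ ⊥) :
    ∃ P : Ideal (MvPolynomial (σ × σ) ℂ), P.IsPrime ∧ ¬ P.IsMaximal ∧
      P ≤ MvPolynomial.vanishingIdeal ℂ {fun ij : σ × σ => (1 : Matrix σ σ ℂ) ij.1 ij.2} ∧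
      ∀ A : Matrix σ σ ℂ, P ≤ MvPolynomial.vanishingIdeal ℂ {fun ij : σ × σ => A ij.1 ij.2} →
        linSubst σ ℂ A f = f := by
  classical
  -- the orbit comorphism `Φ : F ↦ F(Y·f)` and the fibre ideal `J` over the point `f`
  set Φ : MvPolynomial (DegIdx σ D) ℂ →ₐ[ℂ] MvPolynomial (σ × σ) ℂ :=
    aeval fun d : DegIdx σ D => OrbitDim.orbitMapCoeff f d.1 with hΦ
  set J : Ideal (MvPolynomial (σ × σ) ℂ) := (MvPolynomial.vanishingIdeal ℂ {formCoeff D f}).map Φ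
    with hJ
  have hN : 1 ≤ Module.finrank ℂ (glAnn f) := by
    rw [Nat.one_le_iff_ne_zero, Ne, Submodule.finrank_eq_zero]
    exact hne
  have hNle : Module.finrank ℂ (glAnn f) ≤ Fintype.card σ ^ 2 := by
    have := finrank_glTangent_add_finrank_glAnn f
    omega
  -- the rings `A = ℂ[Y]`, `B = ℂ[Δ(f)]` and the comorphism `φ`
  haveI : IsDomain (OrbitCoordRing f D) := isDomain_orbitCoordRing f D
  haveI : Algebra.FiniteType ℂ (OrbitCoordRing f D) :=
    Algebra.FiniteType.of_surjective (Ideal.Quotient.mkₐ ℂ (orbitVanishingIdeal f D))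
      (Ideal.Quotient.mkₐ_surjective ℂ _)
  have hker : ∀ b : MvPolynomial (DegIdx σ D) ℂ, b ∈ orbitVanishingIdeal f D → Φ b = 0 := by
    intro b hb
    rw [orbitVanishingIdeal_eq_ker_genericOrbitMap] at hb
    exact hb
  let φ : OrbitCoordRing f D →ₐ[ℂ] MvPolynomial (σ × σ) ℂ :=
    Ideal.Quotient.liftₐ (orbitVanishingIdeal f D) Φ hker
  have hφmk : ∀ b, φ (Ideal.Quotient.mk (orbitVanishingIdeal f D) b) = Φ b := by
    intro b
    rw [Ideal.Quotient.liftₐ_apply, Ideal.Quotient.lift_mk]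
    rfl
  -- the point `f` of `B` and its maximal ideal `m`
  have hImf : orbitVanishingIdeal f D ≤ MvPolynomial.vanishingIdeal ℂ {formCoeff D f} := by
    unfold orbitVanishingIdeal
    exact MvPolynomial.vanishingIdeal_anti_mono
      (Set.singleton_subset_iff.mpr ⟨f, mem_glOrbit_self f, rfl⟩)
  let m : Ideal (OrbitCoordRing f D) :=
    (MvPolynomial.vanishingIdeal ℂ {formCoeff D f}).map (Ideal.Quotient.mk (orbitVanishingIdeal f D))
  have hkle : RingHom.ker (Ideal.Quotient.mk (orbitVanishingIdeal f D)) ≤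
      MvPolynomial.vanishingIdeal ℂ {formCoeff D f} := by
    rw [Ideal.mk_ker]
    exact hImf
  haveI hmmax : m.IsMaximal :=
    Ideal.IsMaximal.map_of_surjective_of_ker_le Ideal.Quotient.mk_surjective hkle
  have hmφ : m.map φ = J := by
    apply le_antisymm
    · rw [Ideal.map_le_iff_le_comap, Ideal.map_le_iff_le_comap]
      intro b hb
      rw [Ideal.mem_comap, Ideal.mem_comap, hφmk]
      exact Ideal.mem_map_of_mem _ hb
    · rw [hJ, Ideal.map_le_iff_le_comap]
      intro b hb
      rw [Ideal.mem_comap, ← hφmk]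
      exact Ideal.mem_map_of_mem _ (Ideal.mem_map_of_mem _ hb)
  -- a minimal prime of the fibre ideal below the point `1`
  haveI h𝔪₁ : (MvPolynomial.vanishingIdeal ℂ {fun ij : σ × σ => (1 : Matrix σ σ ℂ) ij.1 ij.2} :
      Ideal (MvPolynomial (σ × σ) ℂ)).IsPrime := inferInstance
  have hm₁ : m.map φ ≤
      MvPolynomial.vanishingIdeal ℂ {fun ij : σ × σ => (1 : Matrix σ σ ℂ) ij.1 ij.2} := by
    rw [hmφ, hJ, hΦ]
    exact fibreIdeal_le_of_linSubst_eq (by rw [linSubst_one, AlgHom.id_apply])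
  obtain ⟨P, hPmin, hP₁⟩ := Ideal.exists_minimalPrimes_le hm₁
  haveI hP : P.IsPrime := hPmin.1.1
  have hmP : m.map φ ≤ P := hPmin.1.2
  refine ⟨P, hP, ?_, hP₁, fun A hA => linSubst_eq_of_fibreIdeal_le hf ((hmφ ▸ hmP).trans hA)⟩
  -- the fibre inequality and the two dimensions
  intro hPmax
  have hfib := ringKrullDim_le_ringKrullDim_quotient_add ℂ φ m P hPmin
  have hA : ringKrullDim (MvPolynomial (σ × σ) ℂ) = ((Fintype.card σ ^ 2 : ℕ) : WithBot ℕ∞) := by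
    rw [MvPolynomial.ringKrullDim_of_isNoetherianRing, ringKrullDim_eq_zero_of_field ℂ, zero_add,
      Nat.card_eq_fintype_card, Fintype.card_prod, sq]
  have hB : ringKrullDim (OrbitCoordRing f D) =
      ((Fintype.card σ ^ 2 - Module.finrank ℂ (glAnn f) : ℕ) : WithBot ℕ∞) := by
    rw [ringKrullDim_orbitCoordRing_eq_affineDimension_orbitClosure hf,
      affineDimension_orbitClosure_eq_card_sq_sub_finrank_glAnn hf]
  have hAP : ringKrullDim (MvPolynomial (σ × σ) ℂ ⧸ P) = 0 := by
    letI := Ideal.Quotient.field P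
    exact ringKrullDim_eq_zero_of_field _
  rw [hA, hAP, hB, zero_add, ← WithBot.coe_natCast, ← WithBot.coe_natCast, WithBot.coe_le_coe,
    Nat.cast_le] at hfib
  omega

/-- **A finite stabilizer forces `glAnn f = 0`** (for a form `f` of degree `D` over `ℂ`): if
`glAnn f ≠ 0`, the fibre of the orbit map over `f` — the set of matrices `A` with `A·f = f` — has a
positive-dimensional component `Z(P)` through `Y = 1` (`exists_fibre_prime_not_isMaximal`); since
`det Y ∉ P`, it carries infinitely many invertible points (`infinite_points_of_not_isMaximal`), all in
`stab(f)`. [cite: SpringerLAG1998, 5.1.6] -/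
theorem glAnn_eq_bot_of_finite_linStabilizer {f : MvPolynomial σ ℂ} {D : ℕ}
    (hf : f.IsHomogeneous D) (hfin : Finite (linStabilizer f)) : glAnn f = ⊥ := by
  classical
  by_contra hne
  obtain ⟨P, hP, hPmax, hP₁, hJP⟩ := exists_fibre_prime_not_isMaximal hf hne
  -- the generic determinant does not lie in `P`
  have haevdet : ∀ x : σ × σ → ℂ, aeval x (Matrix.mvPolynomialX σ σ ℂ).det =
      (Matrix.of fun i j => x (i, j)).det := by
    intro x
    rw [AlgHom.map_det, AlgHom.mapMatrix_apply]
    congr 1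
    ext i j
    simp only [Matrix.map_apply, Matrix.mvPolynomialX_apply, aeval_X, Matrix.of_apply]
  have hdetP : (Matrix.mvPolynomialX σ σ ℂ).det ∉ P := by
    intro hdet
    have h1 := (MvPolynomial.mem_vanishingIdeal_singleton_iff _ _).mp (hP₁ hdet)
    rw [haevdet] at h1
    have hone : (Matrix.of fun i j => (fun ij : σ × σ => (1 : Matrix σ σ ℂ) ij.1 ij.2) (i, j)) = 1 := by
      ext i j; rfl
    rw [hone, Matrix.det_one] at h1
    exact one_ne_zero h1
  -- infinitely many invertible zeros of `P`, all stabilizing `f`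
  have hTinf := infinite_points_of_not_isMaximal P hPmax hdetP
  set T := {x : σ × σ → ℂ | (∀ p ∈ P, aeval x p = 0) ∧ aeval x (Matrix.mvPolynomialX σ σ ℂ).det ≠ 0}
    with hT
  have hdetT : ∀ x ∈ T, (Matrix.of fun i j => x (i, j)).det ≠ 0 := fun x hx => by
    rw [← haevdet]; exact hx.2
  have hstab : ∀ x ∈ T, linSubst σ ℂ (Matrix.of fun i j => x (i, j)) f = f := by
    intro x hx
    apply hJP
    have hxA : (fun ij : σ × σ => (Matrix.of fun i j => x (i, j)) ij.1 ij.2) = x := by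
      funext ij; simp only [Matrix.of_apply, Prod.mk.eta]
    rw [hxA]
    exact fun p hp => (MvPolynomial.mem_vanishingIdeal_singleton_iff x p).mpr (hx.1 p hp)
  let ι : T → linStabilizer f := fun x =>
    ⟨Matrix.GeneralLinearGroup.mkOfDetNeZero _ (hdetT x.1 x.2), by
      rw [mem_linStabilizer, linSubstRep_apply, Matrix.GeneralLinearGroup.val_mkOfDetNeZero]
      exact hstab x.1 x.2⟩
  have hι : Function.Injective ι := by
    intro x x' hxx'
    apply Subtype.ext
    have h1 : ((ι x : GL σ ℂ) : Matrix σ σ ℂ) = ((ι x' : GL σ ℂ) : Matrix σ σ ℂ) := by rw [hxx']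
    simp only [ι, Matrix.GeneralLinearGroup.val_mkOfDetNeZero] at h1
    funext ij
    have h2 := congr_fun (congr_fun h1 ij.1) ij.2
    simpa only [Matrix.of_apply, Prod.mk.eta] using h2
  haveI : Infinite T := hTinf.to_subtype
  exact (Infinite.of_injective ι hι).not_finite hfin

/-- **The Lie-algebra criterion**: a form `f` over `ℂ` has finite stabilizer in `GL(W)` iff its
annihilator `𝔤𝔩(W)_f` (the Lie algebra of the stabilizer) vanishes.
[cite: SpringerLAG1998, Thm 4.3.3 (iii) and 5.1.6] -/
theorem finite_linStabilizer_iff_glAnn_eq_bot {f : MvPolynomial σ ℂ} {D : ℕ}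
    (hf : f.IsHomogeneous D) : Finite (linStabilizer f) ↔ glAnn f = ⊥ :=
  ⟨glAnn_eq_bot_of_finite_linStabilizer hf, finite_linStabilizer_of_glAnn_eq_bot f⟩

end Converse

/-! ### Openness: the maximal minors of the infinitesimal action -/

section Minors

/-- A matrix over `ℂ` with injective `mulVec` (independent columns) has a non-singular square
submatrix on some rows. [folklore] -/
private theorem exists_submatrix_det_ne_zero' {ρ κ : Type*} [Fintype ρ] [Fintype κ] [DecidableEq κ]
    (A : Matrix ρ κ ℂ) (hA : Function.Injective A.mulVec) :
    ∃ e : κ → ρ, (A.submatrix e id).det ≠ 0 := by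
  classical
  have hrank : A.rank = Fintype.card κ := by
    have hinj : Function.Injective A.mulVecLin := fun x y hxy => hA hxy
    rw [Matrix.rank, LinearMap.finrank_range_of_inj hinj, Module.finrank_fintype_fun_eq_card]
  obtain ⟨κ', a, ha, hspan, hli⟩ := exists_linearIndependent' (K := ℂ) A.row
  haveI : Finite κ' := hli.finite
  letI : Fintype κ' := Fintype.ofFinite κ'
  have hcard : Fintype.card κ' = Fintype.card κ := by
    rw [linearIndependent_iff_card_eq_finrank_span.mp hli, Set.finrank, hspan,
      ← Matrix.rank_eq_finrank_span_row, hrank]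
  obtain ⟨e⟩ : Nonempty (κ ≃ κ') := Fintype.card_eq.mp hcard.symm
  refine ⟨a ∘ e, ?_⟩
  have hli' : LinearIndependent ℂ (A.submatrix (a ∘ e) id).row := by
    have : (A.submatrix (a ∘ e) id).row = (A.row ∘ a) ∘ e := by
      funext i; rfl
    rw [this]
    exact hli.comp e e.injective
  have hU := Matrix.linearIndependent_rows_iff_isUnit.mp hli'
  rw [Matrix.isUnit_iff_isUnit_det] at hU
  exact hU.ne_zero

/-- The generic infinitesimal-action matrix specialises at a form `f` of degree `D` to the numerical
matrix `(coeff_δ (x_a ∂_b f))_{δ,(a,b)}`: its `(δ,(a,b))` entry is the linear form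
`∑_γ coeff_δ(x_a ∂_b x^γ) · c_γ` in the coefficients `c_γ` of `f`. [folklore] -/
private theorem tangentMatrixGen_map_aeval {D : ℕ} {f : MvPolynomial σ ℂ} (hf : f.IsHomogeneous D) :
    (Matrix.of fun (δ : DegIdx σ D) (ab : σ × σ) =>
        ∑ γ : DegIdx σ D, C (coeff δ.1 (X ab.1 * pderiv ab.2 (monomial γ.1 (1 : ℂ)))) * X γ).map
        (aeval (formCoeff D f)) =
      Matrix.of fun (δ : DegIdx σ D) (ab : σ × σ) => coeff δ.1 (X ab.1 * pderiv ab.2 f) := by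
  ext δ ab
  simp only [Matrix.map_apply, Matrix.of_apply, map_sum, map_mul, aeval_C, aeval_X, formCoeff_apply]
  -- linearity of `p ↦ coeff δ (x_a ∂_b p)` against `f = ∑_γ coeff_γ f • x^γ`
  conv_rhs => rw [← sum_coeff_smul_monomial_eq hf]
  simp only [map_sum, Derivation.map_smul, Finset.mul_sum, mul_smul_comm, coeff_sum, coeff_smul,
    smul_eq_mul]
  refine Finset.sum_congr rfl fun γ _ => ?_
  rw [Algebra.algebraMap_self_apply, mul_comm]

/-- `(T_f · vec M)_δ = coeff_δ (M·f)` for the numerical infinitesimal-action matrix `T_f`. [folklore] -/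
private theorem tangentMatrix_mulVec (D : ℕ) (f : MvPolynomial σ ℂ) (M : Matrix σ σ ℂ)
    (δ : DegIdx σ D) :
    (Matrix.of fun (δ : DegIdx σ D) (ab : σ × σ) => coeff δ.1 (X ab.1 * pderiv ab.2 f)).mulVec
        (fun ab : σ × σ => M ab.1 ab.2) δ = coeff δ.1 (glTangentMap f M) := by
  rw [coeff_glTangentMap, Matrix.mulVec, dotProduct, Fintype.sum_prod_type]
  refine Finset.sum_congr rfl fun a _ => Finset.sum_congr rfl fun b _ => ?_
  simp only [Matrix.of_apply]
  ring

/-- `glAnn f = 0` iff the numerical infinitesimal-action matrix has injective `mulVec`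
(full column rank). [folklore] -/
private theorem glAnn_eq_bot_iff_injective {D : ℕ} {f : MvPolynomial σ ℂ} (hf : f.IsHomogeneous D) :
    glAnn f = ⊥ ↔ Function.Injective
      (Matrix.of fun (δ : DegIdx σ D) (ab : σ × σ) => coeff δ.1 (X ab.1 * pderiv ab.2 f)).mulVec := by
  constructor
  · intro h w w' hww'
    -- `M - M'` annihilates `f`
    set M : Matrix σ σ ℂ := Matrix.of fun a b => w (a, b) - w' (a, b) with hM
    have hvec : (fun ab : σ × σ => M ab.1 ab.2) = w - w' := by
      funext ab; simp [hM]
    have hzero : glTangentMap f M = 0 := by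
      apply formCoeff_injOn_homogeneousSubmodule D
        ((mem_homogeneousSubmodule D _).mpr (glTangentMap_isHomogeneous hf M))
        (Submodule.zero_mem _)
      funext δ
      rw [formCoeff_apply, formCoeff_apply, coeff_zero, ← tangentMatrix_mulVec, hvec,
        Matrix.mulVec_sub, hww', sub_self, Pi.zero_apply]
    have hM0 : M = 0 := by
      have hmem : M ∈ glAnn f := (mem_glAnn_iff_glTangentMap_eq_zero f M).mpr hzero
      rw [h] at hmem
      exact (Submodule.mem_bot ℂ).mp hmem
    funext ab
    have := congr_fun (congr_fun hM0 ab.1) ab.2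
    simp only [hM, Matrix.of_apply, Matrix.zero_apply, sub_eq_zero] at this
    simpa using this
  · intro h
    rw [Submodule.eq_bot_iff]
    intro M hM
    rw [mem_glAnn_iff_glTangentMap_eq_zero] at hM
    have hvec : (Matrix.of fun (δ : DegIdx σ D) (ab : σ × σ) =>
        coeff δ.1 (X ab.1 * pderiv ab.2 f)).mulVec (fun ab : σ × σ => M ab.1 ab.2) = 0 := by
      funext δ
      rw [tangentMatrix_mulVec, hM, coeff_zero, Pi.zero_apply]
    rw [← Matrix.mulVec_zero (Matrix.of fun (δ : DegIdx σ D) (ab : σ × σ) =>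
      coeff δ.1 (X ab.1 * pderiv ab.2 f))] at hvec
    have h0 := h hvec
    ext a b
    exact congr_fun h0 (a, b)

/-- **Openness of the finite-stabilizer locus**: a form `f` of degree `D` has finite stabilizer
iff some maximal minor of the generic infinitesimal-action matrix
`(∑_γ coeff_δ(x_a ∂_b x^γ) · c_γ)_{δ,(a,b)}` (entries linear forms in the coordinates `c_γ` of
`Sym^D`) does not vanish at `f` — `stab(f)` finite `⇔ glAnn f = 0 ⇔` the matrix
`(coeff_δ(x_a ∂_b f))` has full column rank. [cite: BurgisserIkenmeyer2017, Thm. 2.3] -/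
theorem finite_linStabilizer_iff_exists_tangentMinor_ne_zero {D : ℕ} {f : MvPolynomial σ ℂ}
    (hf : f.IsHomogeneous D) :
    Finite (linStabilizer f) ↔
      ∃ F ∈ Set.range (fun e : σ × σ → DegIdx σ D =>
        ((Matrix.of fun (δ : DegIdx σ D) (ab : σ × σ) =>
          ∑ γ : DegIdx σ D, C (coeff δ.1 (X ab.1 * pderiv ab.2 (monomial γ.1 (1 : ℂ)))) *
            X γ).submatrix e id).det),
        aeval (formCoeff D f) F ≠ 0 := by
  classical
  rw [finite_linStabilizer_iff_glAnn_eq_bot hf, glAnn_eq_bot_iff_injective hf]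
  set T : Matrix (DegIdx σ D) (σ × σ) ℂ :=
    Matrix.of fun (δ : DegIdx σ D) (ab : σ × σ) => coeff δ.1 (X ab.1 * pderiv ab.2 f) with hT
  have hminor : ∀ e : σ × σ → DegIdx σ D, aeval (formCoeff D f)
      ((Matrix.of fun (δ : DegIdx σ D) (ab : σ × σ) =>
        ∑ γ : DegIdx σ D, C (coeff δ.1 (X ab.1 * pderiv ab.2 (monomial γ.1 (1 : ℂ)))) *
          X γ).submatrix e id).det = (T.submatrix e id).det := by
    intro e
    rw [AlgHom.map_det, AlgHom.mapMatrix_apply, ← Matrix.submatrix_map, tangentMatrixGen_map_aeval hf]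
  constructor
  · intro h
    obtain ⟨e, he⟩ := exists_submatrix_det_ne_zero' _ h
    exact ⟨_, ⟨e, rfl⟩, by rwa [hminor]⟩
  · rintro ⟨_, ⟨e, rfl⟩, he⟩
    rw [hminor] at he
    intro w w' hww'
    rw [← sub_eq_zero]
    apply Matrix.eq_zero_of_mulVec_eq_zero he
    rw [Matrix.mulVec_sub]
    have h1 : (T.submatrix e id).mulVec w = (T.submatrix e id).mulVec w' := by
      funext i
      have := congr_fun hww' (e i)
      simpa [Matrix.mulVec, dotProduct, Matrix.submatrix_apply] using this
    rw [h1, sub_self]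

end Minors

/-! ### The witness: the Fermat form has zero annihilator -/

section Fermat

omit [Fintype σ] [DecidableEq σ] in
/-- For `D ≥ 3` the exponent vectors of the monomials `x_a x_b^{D-1}` are pairwise distinct.
[folklore] -/
private theorem single_add_single_inj {D : ℕ} (hD : 3 ≤ D) {a b a' b' : σ}
    (h : (Finsupp.single a 1 + Finsupp.single b (D - 1) : σ →₀ ℕ) =
      Finsupp.single a' 1 + Finsupp.single b' (D - 1)) : a = a' ∧ b = b' := by
  classical
  have ha := DFunLike.congr_fun h a
  have hb := DFunLike.congr_fun h b
  simp only [Finsupp.add_apply, Finsupp.single_apply] at ha hb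
  have haa' : a = a' := by
    by_contra hne
    rw [if_neg (Ne.symm hne)] at ha
    by_cases hab' : b' = a
    · rw [if_pos hab'] at ha
      split_ifs at ha <;> omega
    · rw [if_neg hab'] at ha
      split_ifs at ha <;> omega
  subst haa'
  refine ⟨rfl, ?_⟩
  by_contra hne
  rw [if_neg (Ne.symm hne)] at hb
  split_ifs at hb <;> omega

/-- **The Fermat form `x_1^D + ⋯ + x_m^D` has zero annihilator for `D ≥ 3`**: `X·∑ x_i^D =
D ∑_{a,b} X_{ab} x_a x_b^{D−1}` and the monomials `x_a x_b^{D−1}` are distinct. (For `D = 2` the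
annihilator is `𝔰𝔬_m`, cf. BI 2017, remark after Thm. 2.3.) [cite: BurgisserIkenmeyer2017, Prop. 2.4 (2)] -/
theorem glAnn_sum_X_pow_eq_bot {D : ℕ} (hD : 3 ≤ D) :
    glAnn (∑ i : σ, (X i : MvPolynomial σ ℂ) ^ D) = ⊥ := by
  classical
  rw [Submodule.eq_bot_iff]
  intro M hM
  rw [mem_glAnn_iff_glTangentMap_eq_zero] at hM
  -- `∂_b ∑ x_i^D = D x_b^{D-1}`
  have hpd : ∀ b : σ, pderiv b (∑ i : σ, (X i : MvPolynomial σ ℂ) ^ D) =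
      (D : ℂ) • X b ^ (D - 1) := by
    intro b
    rw [map_sum, Finset.sum_eq_single b]
    · rw [(pderiv b).leibniz_pow, pderiv_X_self, smul_eq_mul, mul_one, Nat.cast_smul_eq_nsmul]
    · intro i _ hib
      rw [(pderiv b).leibniz_pow, pderiv_X_of_ne hib, smul_zero, smul_zero]
    · intro h; exact absurd (Finset.mem_univ b) h
  -- the monomial `x_a x_b^{D-1}`
  have hmon : ∀ a b : σ, (X a * X b ^ (D - 1) : MvPolynomial σ ℂ) =
      monomial (Finsupp.single a 1 + Finsupp.single b (D - 1)) 1 := by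
    intro a b
    rw [X, X_pow_eq_monomial, monomial_mul, one_mul]
  ext a b
  have hcoeff := congrArg (coeff (Finsupp.single a 1 + Finsupp.single b (D - 1))) hM
  rw [coeff_zero, coeff_glTangentMap] at hcoeff
  simp_rw [hpd, mul_smul_comm, coeff_smul, hmon, coeff_monomial] at hcoeff
  rw [Finset.sum_eq_single a, Finset.sum_eq_single b, if_pos rfl] at hcoeff
  · simp only [smul_eq_mul, mul_one] at hcoeff
    have hD0 : (D : ℂ) ≠ 0 := Nat.cast_ne_zero.mpr (by omega)
    simpa [hD0] using hcoeff
  · intro b' _ hb'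
    rw [if_neg, smul_zero, mul_zero]
    intro h; exact hb' (single_add_single_inj hD h).2
  · intro h; exact absurd (Finset.mem_univ b) h
  · intro a' _ ha'
    refine Finset.sum_eq_zero fun b' _ => ?_
    rw [if_neg, smul_zero, mul_zero]
    intro h; exact ha' (single_add_single_inj hD h).1
  · intro h; exact absurd (Finset.mem_univ a) h

end Fermat

/-! ### The discharge -/

section Discharge

/-- **BI 2017, Thm. 2.3, first sentence** ("Let `D > 2` and `m ≥ 1`. The set of `w ∈ Sym^D ℂ^m`
with finite stabilizer is a nonempty open subset of `W`", `paper:arxiv-1511.02927` p0006.txt:L56–58)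
— DISCHARGE of the named fact `BI2017_thm_2_3_open` (`BI17FundamentalInvariantForms.lean`). The
complement of the locus is cut out by the maximal minors of the generic
infinitesimal-action matrix (`finite_linStabilizer_iff_exists_tangentMinor_ne_zero`: `stab(f)` finite
iff `𝔤𝔩(W)_f = 0` iff the matrix has full rank), and the Fermat form `∑ x_i^D` lies in the locus
(`glAnn_sum_X_pow_eq_bot` with `finite_linStabilizer_of_glAnn_eq_bot`). The print "indicates the
proof in the Appendix" (generic stabilizers after Matsumura–Monsky); this proof is the standard
Lie-algebra/upper-semicontinuity argument. [cite: BurgisserIkenmeyer2017, Thm. 2.3] -/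
theorem BI2017_thm_2_3_open_holds : BI2017_thm_2_3_open := by
  intro D m hD _hm
  refine ⟨⟨_, fun f hf => finite_linStabilizer_iff_exists_tangentMinor_ne_zero hf⟩, ?_⟩
  refine ⟨∑ i : Fin m, (X i : MvPolynomial (Fin m) ℂ) ^ D,
    IsHomogeneous.sum _ _ _ fun i _ => isHomogeneous_X_pow i D, ?_⟩
  exact finite_linStabilizer_of_glAnn_eq_bot _ (glAnn_sum_X_pow_eq_bot (by omega))

end Discharge

/-! ### Corollary: finite stabilizers are Zariski-generic -/

section Generic

/-- **BI 2017, Thm. 2.3, first sentence, in the "almost all" language of §2.1** ("almost all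
`w ∈ Sym^D ℂ^m`", the tree's `IsZariskiGeneric`): for `D > 2` and `m ≥ 1`, almost all forms of degree
`D` in `m` variables have a FINITE stabilizer — a nonempty open subset of `Sym^D ℂ^m` contains the
complement of a hypersurface. Unconditional form of the genericity of finite stabilizers used in the
proof of Prop. 2.10 (`paper:arxiv-1511.02927` p0007.txt:L73–77: "SL_m ∩ stab(w) is finite for almost
all w"); cf. the conditional `poonen2005_thm_3.isZariskiGeneric_finite_linStabilizer`.
[cite: BurgisserIkenmeyer2017, Thm. 2.3] -/
theorem isZariskiGeneric_finite_linStabilizer {D m : ℕ} (hD : 2 < D) (hm : 1 ≤ m) :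
    IsZariskiGeneric D (fun f : MvPolynomial (Fin m) ℂ => Finite (linStabilizer f)) := by
  obtain ⟨⟨S, hS⟩, f₀, hf₀, hfin₀⟩ := BI2017_thm_2_3_open_holds D m hD hm
  obtain ⟨F, hFS, hF₀⟩ := (hS f₀ hf₀).mp hfin₀
  refine ⟨F, fun hF => hF₀ (by rw [hF, map_zero]), fun f hf hFf => (hS f hf).mpr ⟨F, hFS, hFf⟩⟩

/-- The same for the stabilizer in `SL_m`: for `D > 2`, `m ≥ 1`, almost all forms `w ∈ Sym^D ℂ^m`
have finite `SL_m ∩ stab(w)` (the hypothesis of Luna's/Popov's criterion in the printed proof of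
BI 2017 Prop. 2.10, p0007.txt:L73–77). [cite: BurgisserIkenmeyer2017, Prop. 2.10 (proof)] -/
theorem isZariskiGeneric_finite_slStabilizer {D m : ℕ} (hD : 2 < D) (hm : 1 ≤ m) :
    IsZariskiGeneric D (fun f : MvPolynomial (Fin m) ℂ =>
      {g : Matrix.SpecialLinearGroup (Fin m) ℂ | linSubst (Fin m) ℂ (g : Matrix (Fin m) (Fin m) ℂ) f = f}.Finite) := by
  obtain ⟨F, hF, hgen⟩ := isZariskiGeneric_finite_linStabilizer hD hm
  refine ⟨F, hF, fun f hf hFf => ?_⟩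
  have hfin : Finite (linStabilizer f) := hgen f hf hFf
  -- `g ↦ (g : GL_m)` injects the `SL`-stabilizer into the (finite) `GL`-stabilizer
  let ι : {g : Matrix.SpecialLinearGroup (Fin m) ℂ |
      linSubst (Fin m) ℂ (g : Matrix (Fin m) (Fin m) ℂ) f = f} → linStabilizer f :=
    fun g => ⟨Matrix.SpecialLinearGroup.toGL (g : Matrix.SpecialLinearGroup (Fin m) ℂ), by
      rw [mem_linStabilizer, linSubstRep_apply]
      exact g.2⟩
  have hι : Function.Injective ι := by
    intro g g' hgg'
    have h1 := congrArg (fun u : linStabilizer f => ((u : GL (Fin m) ℂ) : Matrix (Fin m) (Fin m) ℂ)) hgg'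
    exact Subtype.ext (Subtype.ext h1)
  haveI : Finite {g : Matrix.SpecialLinearGroup (Fin m) ℂ |
      linSubst (Fin m) ℂ (g : Matrix (Fin m) (Fin m) ℂ) f = f} := Finite.of_injective ι hι
  exact Set.toFinite _

end Generic

end Literature.Computability.AlgebraicComplexity

end
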